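import Mathlib
import Summits.Parity.BatemanHorn.Theorems.IsogenyRedeiSplitBlockJacobiPureDigitPiecesPV
import Summits.Parity.BatemanHorn.Theorems.IsogenyRedeiSplitBlockJacobiPureDigitPiecesPowPV
import HarnessLib

/-!
# Route `IsogenyRedei`, crux `SplitBlockJacobi` (stmt-Parity-11583), line `split-mass-middle-prime`:
# tools for the pure digit pieces in the Burgess range (auxiliary file)

The registered stub `stub_pureDigitPiecesPow` of the line skeleton asks, for `1/2 < θ < θ′ < 1`,
`0 < η`, `θ′ + η < 1`, for a power saving `O(x^{1-δ})` in the `ℓ¹`-sum over `(Q, ν, k, a)` —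
primes `x^θ < Q ≤ x^{θ′}`, roots `ν² ≡ −1 (mod Q)`, moduli `1 ≤ k ≤ x^η`, root classes `a mod k` —
of the absolute digit-character sums `Σ_{u : ν + Q(a+ku) ≤ x} ((ν²+1)/Q + 2ν(a+ku) | Q)`.
The tree proves it in the Pólya–Vinogradov range `θ′/2 < 1 − θ′ − η`
(`pureDigitPiecesPow_of_polyaVinogradov_range`).  The companion file
`IsogenyRedeiSplitBlockJacobiPureDigitPiecesBurgess` proves it in the **Burgess range**
`θ′/4 < 1 − θ′ − η` conditionally on Burgess's bound (Iwaniec–Kowalski Thm 12.6, an explicit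
hypothesis there); this file supplies its tools, all `--supports` helpers (nothing is closed):

* `abs_sum_range_jacobiSym_linear_le_of_intervalBound`, `abs_inner_le_of_intervalBound` — the
  reduction of the inner sums `Σ_{u<H} (α + βu | Q)` (`Q ∤ β`) to sums of `(· | Q)` over `H`
  consecutive integers (the tree's `abs_sum_range_jacobiSym_linear_le` with an abstract interval
  bound in place of Pólya–Vinogradov), and `H ≤ x/(Qk) + 1`;
* `sum_div_le_sum_div_add_log`, `sum_div_le_mul_one_add_log`, `exists_sum_rho_le_nat` — partial
  summation against `1/k` (`Σ_{k≤K} w(k)/k ≤ C(1 + log K)` when `Σ_{k≤n} w(k) ≤ Cn`), and the tree's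
  `Σ_{m≤n} ρ(m) ≤ Cn` (`Iwaniec1978.exists_sum_rho_le`) for all `n ≥ 1` (the harmonic bound itself
  is the tree's `RobertSargos.sum_inv_Icc_le_log`);
* `sum_sum_sum_sum_mul_le`, `sum_sum_sum_sum_le_of_le_mul_add` — the bookkeeping over
  `(Q, ν, k, a)` keeping the `Q`- and `k`-dependence of the inner bounds (root classes `≤ ρ(k)`,
  `≤ 2` roots `ν`), refining the tree's `sum_sum_sum_sum_le`;
* `rpow_mul_one_add_log_pow_three_isBigO` — `x^s (1 + log x)³ = O(x^{s+ε})` (subadditivity of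
  `t ↦ t^s`, `0 ≤ s ≤ 1`, is Mathlib's `Real.rpow_add_le_add_rpow`).

No new definitions; everything is proved (no named facts).
-/

noncomputable section

open Filter Finset Asymptotics
open scoped Classical

open Literature.NumberTheory.Sieve.Iwaniec1978 (rho rho_le_two exists_sum_rho_le)

namespace Summit.Parity.BatemanHorn.Cruxes.SplitBlockJacobi.SplitMassMiddlePrime

/-! ### Legendre sums along a linear form, from an interval bound -/

/-- **Reduction of a linear-form Legendre sum to an interval sum.** For `Q` prime, `Q ∤ β`, any
`α` and `H`: if every sum of `(· | Q)` over `H` consecutive integers `(M, M + H]` has modulus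
`≤ B`, then `|Σ_{u < H} (α + βu | Q)| ≤ B`.  Indeed `α + βu ≡ β (M + 1 + u) (mod Q)` with
`M + 1 ≡ β⁻¹ α`, so the sum is `(β | Q) · Σ_{M < n ≤ M + H} (n | Q)` and `|(β | Q)| = 1`.
[folklore] -/
theorem abs_sum_range_jacobiSym_linear_le_of_intervalBound {Q : ℕ} (hQ : Q.Prime) {β : ℕ}
    (hβ : ¬ Q ∣ β) (α H : ℕ) {B : ℝ}
    (hB : ∀ M : ℕ, |∑ n ∈ Finset.Ioc M (M + H), (jacobiSym (n : ℤ) Q : ℝ)| ≤ B) :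
    |∑ u ∈ Finset.range H, (jacobiSym ((α + β * u : ℕ) : ℤ) Q : ℝ)| ≤ B := by
  haveI : Fact Q.Prime := ⟨hQ⟩
  have hβ0 : (β : ZMod Q) ≠ 0 := by
    rw [Ne, ZMod.natCast_eq_zero_iff]; exact hβ
  set M : ℕ := ((β : ZMod Q)⁻¹ * α - 1).val with hM
  -- pointwise: `(α + βu | Q) = (β | Q) (M + 1 + u | Q)`
  have hpt : ∀ u : ℕ, jacobiSym ((α + β * u : ℕ) : ℤ) Q =
      jacobiSym (β : ℤ) Q * jacobiSym ((M + 1 + u : ℕ) : ℤ) Q := by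
    intro u
    rw [← jacobiSym.mul_left]
    refine jacobiSym.mod_left' ((ZMod.intCast_eq_intCast_iff' _ _ Q).1 ?_)
    push_cast
    rw [hM, ZMod.natCast_val, ZMod.cast_id', id, sub_add_cancel, mul_add, ← mul_assoc,
      mul_inv_cancel₀ hβ0, one_mul]
  -- the shifted sum is the interval sum over `(M, M + H]`
  have hshift : ∑ u ∈ Finset.range H, (jacobiSym ((M + 1 + u : ℕ) : ℤ) Q : ℝ) =
      ∑ n ∈ Finset.Ioc M (M + H), (jacobiSym (n : ℤ) Q : ℝ) := by
    rw [← Finset.Ico_add_one_add_one_eq_Ioc, Finset.sum_Ico_eq_sum_range,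
      show M + H + 1 - (M + 1) = H by omega]
  -- `|(β | Q)| = 1`
  have hunit : |(jacobiSym (β : ℤ) Q : ℝ)| = 1 := by
    have hg : (β : ℤ).gcd Q = 1 := by
      rw [Int.gcd_natCast_natCast]
      exact Nat.coprime_comm.1 ((Nat.Prime.coprime_iff_not_dvd hQ).2 hβ)
    rcases jacobiSym.eq_one_or_neg_one hg with h | h <;> simp [h]
  have hsum : ∑ u ∈ Finset.range H, (jacobiSym ((α + β * u : ℕ) : ℤ) Q : ℝ) =
      (jacobiSym (β : ℤ) Q : ℝ) * ∑ n ∈ Finset.Ioc M (M + H), (jacobiSym (n : ℤ) Q : ℝ) := by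
    rw [← hshift, Finset.mul_sum]
    refine Finset.sum_congr rfl fun u _ => ?_
    rw [hpt u, Int.cast_mul]
  rw [hsum, abs_mul, hunit, one_mul]
  exact hB M

/-- **The inner sums of the stub, from an interval bound of Burgess shape.** For `Q` prime with
`Q ∤ 2νk`, `k ≥ 1`, and constants `c, s, b ≥ 0` such that every sum of `(· | Q)` over `N`
consecutive integers has modulus `≤ c N^s Q^b (1 + log Q)`: the digit-character sum over
`{u ≤ x : ν + Q(a + ku) ≤ x}` — an initial segment `u < H` of `ℕ` with `H ≤ x/(Qk) + 1` — of
`(c₀ + 2ν(a + ku) | Q)` has modulus `≤ c (x/(Qk) + 1)^s Q^b (1 + log Q)`. [folklore] -/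
theorem abs_inner_le_of_intervalBound :
    ∀ {Q ν k a x c₀ : ℕ} {c s b : ℝ}, Q.Prime → ¬ Q ∣ 2 * ν * k → 1 ≤ k → 0 ≤ c → 0 ≤ s →
      (∀ M N : ℕ, |∑ n ∈ Finset.Ioc M (M + N), (jacobiSym (n : ℤ) Q : ℝ)| ≤
        c * (N : ℝ) ^ s * (Q : ℝ) ^ b * (1 + Real.log Q)) →
      |∑ u ∈ (Finset.range (x + 1)).filter (fun u : ℕ => ν + Q * (a + k * u) ≤ x),
          (jacobiSym ((c₀ + 2 * ν * (a + k * u) : ℕ) : ℤ) Q : ℝ)| ≤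
        c * ((x : ℝ) / ((Q : ℝ) * k) + 1) ^ s * (Q : ℝ) ^ b * (1 + Real.log Q) := by
  intro Q ν k a x c₀ c s b hQ hβ hk hc hs hBQ
  set U := (Finset.range (x + 1)).filter (fun u : ℕ => ν + Q * (a + k * u) ≤ x) with hU
  have hlow : ∀ u ∈ U, ∀ v ≤ u, v ∈ U := by
    intro u hu v hvu
    simp only [hU, Finset.mem_filter, Finset.mem_range] at hu ⊢
    have : Q * (a + k * v) ≤ Q * (a + k * u) :=
      Nat.mul_le_mul_left _ (Nat.add_le_add_left (Nat.mul_le_mul_left _ hvu) _)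
    omega
  have hQpos : 0 < Q := hQ.pos
  -- `H = #U ≤ x/(Qk) + 1`
  have hcard : (U.card : ℝ) ≤ (x : ℝ) / ((Q : ℝ) * k) + 1 := by
    have hsub : U ⊆ Finset.range (x / (Q * k) + 1) := by
      intro u hu
      simp only [hU, Finset.mem_filter, Finset.mem_range] at hu ⊢
      have h1 : Q * k * u ≤ x := by nlinarith [hu.2]
      exact Nat.lt_succ_of_le
        ((Nat.le_div_iff_mul_le (by positivity)).2 (by linarith [mul_comm (Q * k) u]))
    calc (U.card : ℝ) ≤ ((x / (Q * k) + 1 : ℕ) : ℝ) := by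
          exact_mod_cast (Finset.card_le_card hsub).trans (Finset.card_range _).le
      _ = ((x / (Q * k) : ℕ) : ℝ) + 1 := by push_cast; ring
      _ ≤ (x : ℝ) / ((Q : ℝ) * k) + 1 := by
          gcongr
          · exact_mod_cast (Nat.cast_div_le (α := ℝ)).trans_eq (by push_cast; ring)
  have hLQ : 0 ≤ 1 + Real.log Q :=
    add_nonneg zero_le_one (Real.log_nonneg (by exact_mod_cast hQ.one_lt.le))
  rw [eq_range_card_of_lowerClosed hlow]
  have hsum : ∀ u : ℕ, c₀ + 2 * ν * (a + k * u) = (c₀ + 2 * ν * a) + (2 * ν * k) * u :=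
    fun u => by ring
  rw [Finset.sum_congr rfl fun u _ => by rw [hsum u]]
  refine (abs_sum_range_jacobiSym_linear_le_of_intervalBound hQ hβ _ _
    (fun M => hBQ M U.card)).trans ?_
  gcongr

/-! ### Partial summation against `1/k` -/

/-- **Abel summation against `1/k`.** If `w` has partial sums `Σ_{k ≤ n} w(k) ≤ C n` (`n ≥ 1`,
`C ≥ 0`), then `Σ_{k ≤ K} w(k)/k ≤ (Σ_{k ≤ K} w(k))/K + C log K` for `K ≥ 1` (induction on `K`,
using `1/(K+1) ≤ log(K+1) − log K`). [folklore] -/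
theorem sum_div_le_sum_div_add_log {w : ℕ → ℝ} {C : ℝ} (hC0 : 0 ≤ C)
    (hC : ∀ n : ℕ, 1 ≤ n → ∑ k ∈ Finset.Icc 1 n, w k ≤ C * n) {K : ℕ} (hK : 1 ≤ K) :
    ∑ k ∈ Finset.Icc 1 K, w k / k ≤ (∑ k ∈ Finset.Icc 1 K, w k) / K + C * Real.log K := by
  induction K, hK using Nat.le_induction with
  | base => simp
  | succ K hK ih =>
    rw [Finset.sum_Icc_succ_top (by omega), Finset.sum_Icc_succ_top (by omega)]
    set A : ℝ := ∑ k ∈ Finset.Icc 1 K, w k with hA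
    have hKpos : (0 : ℝ) < K := by exact_mod_cast hK
    have hK0 : (K : ℝ) ≠ 0 := hKpos.ne'
    have hK1 : (K : ℝ) + 1 ≠ 0 := by positivity
    have hAK : A / K ≤ C := by rw [div_le_iff₀ hKpos]; exact hC K hK
    have hlog : 1 / ((K : ℝ) + 1) ≤ Real.log ((K : ℝ) + 1) - Real.log K := by
      have h := Real.one_sub_inv_le_log_of_pos (x := ((K : ℝ) + 1) / K) (by positivity)
      rw [Real.log_div hK1 hK0, inv_div] at h
      have : 1 - (K : ℝ) / ((K : ℝ) + 1) = 1 / ((K : ℝ) + 1) := by field_simp; ring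
      linarith
    have h3 : A / K - A / ((K : ℝ) + 1) ≤ C / ((K : ℝ) + 1) := by
      have : A / K - A / ((K : ℝ) + 1) = (A / K) / ((K : ℝ) + 1) := by field_simp; ring
      rw [this]
      gcongr
    have h4 : C / ((K : ℝ) + 1) ≤ C * (Real.log ((K : ℝ) + 1) - Real.log K) := by
      rw [div_eq_mul_one_div]
      exact mul_le_mul_of_nonneg_left hlog hC0
    push_cast
    rw [add_div]
    linarith

/-- **Harmonic-type bound.** If `w` has partial sums `Σ_{k ≤ n} w(k) ≤ C n` (`n ≥ 1`, `C ≥ 0`),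
then `Σ_{k ≤ K} w(k)/k ≤ C (1 + log K)` for `K ≥ 1`. [folklore] -/
theorem sum_div_le_mul_one_add_log {w : ℕ → ℝ} {C : ℝ} (hC0 : 0 ≤ C)
    (hC : ∀ n : ℕ, 1 ≤ n → ∑ k ∈ Finset.Icc 1 n, w k ≤ C * n) {K : ℕ} (hK : 1 ≤ K) :
    ∑ k ∈ Finset.Icc 1 K, w k / k ≤ C * (1 + Real.log K) := by
  have hKpos : (0 : ℝ) < K := by exact_mod_cast hK
  have hAK : (∑ k ∈ Finset.Icc 1 K, w k) / K ≤ C := by rw [div_le_iff₀ hKpos]; exact hC K hK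
  have := sum_div_le_sum_div_add_log hC0 hC hK
  linarith

/-- **`Σ_{k ≤ n} ρ(k) ≤ C₁ n` for all `n ≥ 1`** (from the tree's `Iwaniec1978.exists_sum_rho_le`,
stated there for real `y ≥ 2`; here `C₁ = 2C`). [folklore] -/
theorem exists_sum_rho_le_nat :
    ∃ C : ℝ, 0 < C ∧ ∀ n : ℕ, 1 ≤ n → ∑ m ∈ Finset.Icc 1 n, (rho m : ℝ) ≤ C * n := by
  obtain ⟨C, hC0, hC⟩ := exists_sum_rho_le
  refine ⟨2 * C, by positivity, fun n hn => ?_⟩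
  have h2 := hC (max (n : ℝ) 2) (le_max_right _ _)
  have hfl : n ≤ ⌊max (n : ℝ) 2⌋₊ := Nat.le_floor (le_max_left _ _)
  calc ∑ m ∈ Finset.Icc 1 n, (rho m : ℝ) ≤ ∑ m ∈ Finset.Icc 1 ⌊max (n : ℝ) 2⌋₊, (rho m : ℝ) :=
        Finset.sum_le_sum_of_subset_of_nonneg (Finset.Icc_subset_Icc_right hfl)
          fun _ _ _ => Nat.cast_nonneg _
    _ ≤ C * max (n : ℝ) 2 := h2
    _ ≤ 2 * C * n := by
        have hn' : (1 : ℝ) ≤ n := by exact_mod_cast hn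
        have : max (n : ℝ) 2 ≤ 2 * n := max_le (by linarith) (by linarith)
        nlinarith

/-! ### Bookkeeping over `(Q, ν, k, a)` with `Q`- and `k`-dependent terms -/

/-- **Abstract bookkeeping, weighted form**: inner terms `g(Q) h(k)` with `g, h ≥ 0`, `a`-counts
`≤ ρ(k)`, `ν`-counts `≤ 2` give the total `≤ (Σ_Q g(Q)) · 2 · Σ_k ρ(k) h(k)`. [folklore] -/
theorem sum_sum_sum_sum_mul_le {SQ Sk : Finset ℕ} {Sν : ℕ → Finset ℕ}
    {Sa : ℕ → ℕ → ℕ → Finset ℕ} {g h : ℕ → ℝ} (hg : ∀ Q ∈ SQ, 0 ≤ g Q)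
    (hh : ∀ k ∈ Sk, 0 ≤ h k)
    (ha : ∀ Q ∈ SQ, ∀ ν ∈ Sν Q, ∀ k ∈ Sk, ((Sa Q ν k).card : ℝ) ≤ rho k)
    (hν : ∀ Q ∈ SQ, ((Sν Q).card : ℝ) ≤ 2) :
    ∑ Q ∈ SQ, ∑ ν ∈ Sν Q, ∑ k ∈ Sk, ∑ _a ∈ Sa Q ν k, g Q * h k ≤
      (∑ Q ∈ SQ, g Q) * (2 * ∑ k ∈ Sk, (rho k : ℝ) * h k) := by
  have hT : 0 ≤ ∑ k ∈ Sk, (rho k : ℝ) * h k :=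
    Finset.sum_nonneg fun k hk => mul_nonneg (Nat.cast_nonneg _) (hh k hk)
  calc ∑ Q ∈ SQ, ∑ ν ∈ Sν Q, ∑ k ∈ Sk, ∑ _a ∈ Sa Q ν k, g Q * h k
      ≤ ∑ Q ∈ SQ, ∑ ν ∈ Sν Q, ∑ k ∈ Sk, (rho k : ℝ) * (g Q * h k) := by
        refine Finset.sum_le_sum fun Q hQ' => Finset.sum_le_sum fun ν hν' =>
          Finset.sum_le_sum fun k hk' => ?_
        rw [Finset.sum_const, nsmul_eq_mul]
        exact mul_le_mul_of_nonneg_right (ha Q hQ' ν hν' k hk') (mul_nonneg (hg Q hQ') (hh k hk'))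
    _ = ∑ Q ∈ SQ, ((Sν Q).card : ℝ) * (g Q * ∑ k ∈ Sk, (rho k : ℝ) * h k) := by
        refine Finset.sum_congr rfl fun Q _ => ?_
        rw [Finset.sum_const, nsmul_eq_mul]
        congr 1
        rw [Finset.mul_sum]
        exact Finset.sum_congr rfl fun k _ => by ring
    _ ≤ ∑ Q ∈ SQ, 2 * (g Q * ∑ k ∈ Sk, (rho k : ℝ) * h k) :=
        Finset.sum_le_sum fun Q hQ' =>
          mul_le_mul_of_nonneg_right (hν Q hQ') (mul_nonneg (hg Q hQ') hT)
    _ = (∑ Q ∈ SQ, g Q) * (2 * ∑ k ∈ Sk, (rho k : ℝ) * h k) := by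
        rw [Finset.sum_mul]
        exact Finset.sum_congr rfl fun Q _ => by ring

/-- **Abstract bookkeeping, mixed form**: inner terms `≤ g(Q) h(k) + B` (`g, h, B ≥ 0`),
`a`-counts `≤ ρ(k)`, `Σ_k ρ(k) ≤ R`, `ν`-counts `≤ 2`, `Q`-count `≤ N` give the total
`≤ (Σ_Q g(Q)) · 2 · Σ_k ρ(k) h(k) + N · 2 · R · B` (`sum_sum_sum_sum_mul_le` plus the tree's
`sum_sum_sum_sum_le`). [folklore] -/
theorem sum_sum_sum_sum_le_of_le_mul_add {SQ Sk : Finset ℕ} {Sν : ℕ → Finset ℕ}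
    {Sa : ℕ → ℕ → ℕ → Finset ℕ} {f : ℕ → ℕ → ℕ → ℕ → ℝ} {g h : ℕ → ℝ} {B R N : ℝ}
    (hB : 0 ≤ B) (hg : ∀ Q ∈ SQ, 0 ≤ g Q) (hh : ∀ k ∈ Sk, 0 ≤ h k)
    (hf : ∀ Q ∈ SQ, ∀ ν ∈ Sν Q, ∀ k ∈ Sk, ∀ a ∈ Sa Q ν k, f Q ν k a ≤ g Q * h k + B)
    (ha : ∀ Q ∈ SQ, ∀ ν ∈ Sν Q, ∀ k ∈ Sk, ((Sa Q ν k).card : ℝ) ≤ rho k)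
    (hk : ∑ k ∈ Sk, (rho k : ℝ) ≤ R) (hν : ∀ Q ∈ SQ, ((Sν Q).card : ℝ) ≤ 2)
    (hQ : (SQ.card : ℝ) ≤ N) (hR : 0 ≤ R) :
    ∑ Q ∈ SQ, ∑ ν ∈ Sν Q, ∑ k ∈ Sk, ∑ a ∈ Sa Q ν k, f Q ν k a ≤
      (∑ Q ∈ SQ, g Q) * (2 * ∑ k ∈ Sk, (rho k : ℝ) * h k) + N * (2 * (R * B)) := by
  calc ∑ Q ∈ SQ, ∑ ν ∈ Sν Q, ∑ k ∈ Sk, ∑ a ∈ Sa Q ν k, f Q ν k a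
      ≤ ∑ Q ∈ SQ, ∑ ν ∈ Sν Q, ∑ k ∈ Sk, ∑ _a ∈ Sa Q ν k, (g Q * h k + B) :=
        Finset.sum_le_sum fun Q hQ' => Finset.sum_le_sum fun ν hν' =>
          Finset.sum_le_sum fun k hk' => Finset.sum_le_sum fun a ha' => hf Q hQ' ν hν' k hk' a ha'
    _ = (∑ Q ∈ SQ, ∑ ν ∈ Sν Q, ∑ k ∈ Sk, ∑ _a ∈ Sa Q ν k, g Q * h k) +
          ∑ Q ∈ SQ, ∑ ν ∈ Sν Q, ∑ k ∈ Sk, ∑ _a ∈ Sa Q ν k, B := by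
        simp only [Finset.sum_add_distrib]
    _ ≤ _ := add_le_add (sum_sum_sum_sum_mul_le hg hh ha hν)
        (sum_sum_sum_sum_le hB (fun _ _ _ _ _ _ _ _ => le_rfl) ha hk hν hQ hR)

/-! ### Absorbing three logarithms -/

/-- **Log absorption, cubed.** For every `ε > 0`: `x^s (1 + log x)^3 = O(x^{s + ε})` along
`x : ℕ → ∞` (three applications of the tree's `pow_isBigO_rpow_mul_one_add_log` with `ε/3`).
[folklore] -/
theorem rpow_mul_one_add_log_pow_three_isBigO {s ε : ℝ} (hε : 0 < ε) :
    (fun x : ℕ => (x : ℝ) ^ s * (1 + Real.log x) ^ 3) =O[Filter.atTop]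
      fun x : ℕ => (x : ℝ) ^ (s + ε) := by
  have hε3 : 0 < ε / 3 := by positivity
  have h1 := pow_isBigO_rpow_mul_one_add_log (s := s) hε3
  have h2 := pow_isBigO_rpow_mul_one_add_log (s := s + ε / 3) hε3
  have h3 := pow_isBigO_rpow_mul_one_add_log (s := s + ε / 3 + ε / 3) hε3
  rw [show s + ε / 3 + ε / 3 + ε / 3 = s + ε by ring] at h3
  have hL : (fun x : ℕ => (1 + Real.log x)) =O[atTop] fun x : ℕ => (1 + Real.log x) :=
    isBigO_refl _ _
  have heq : (fun x : ℕ => (x : ℝ) ^ s * (1 + Real.log x) ^ 3) =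
      fun x : ℕ => (x : ℝ) ^ s * (1 + Real.log x) * (1 + Real.log x) * (1 + Real.log x) := by
    funext x; ring
  rw [heq]
  exact (((h1.mul hL).trans h2).mul hL).trans h3

end Summit.Parity.BatemanHorn.Cruxes.SplitBlockJacobi.SplitMassMiddlePrime

end
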